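import Literature.AlgebraicGeometry.Resolution.ExceptionalCurveIntersectionH0
import HarnessLib

/-!
# `(D·E) = h⁰(𝒪_{E ∩ D})` for an effective Cartier divisor `D` not containing the exceptional curve `E`
# (Lipman 1969, §12 Remark 2 c), p. 221: "`(𝒪_X(𝒟)·C) = h⁰((i^*𝒟))`")

Topic: `Literature/AlgebraicGeometry/Resolution`.  PROVED, fact-free, definition-free.  J. Lipman, *Rational
singularities …*, Publ. Math. IHÉS 36 (1969), §12, Remark 2 c) (p. 221): "If `𝒟` is an effective divisor on `X` whose
support contains no associated point of `C`, then `(𝒪_X(𝒟)·C) = h⁰((i^*𝒟))`" — for the INTEGRAL exceptional curve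
`C = E_η` this reads: for an effective Cartier divisor `D = V(I)` (`I` an invertible ideal sheaf) with `η ∉ V(I)`,
`(D·E_η) = h⁰(𝒪_{E ∩ D}) = h⁰(𝒪_X/(𝓘_η + I))`, the length over the base of the zero-dimensional scheme `E ∩ D`.
This generalises `Resolution/ExceptionalCurveIntersectionH0.toNat_h0_sup_eq_excCurveDegree` (`D = F` a second
exceptional curve) to all effective Cartier `D` avoiding `η` (e.g. the non-exceptional part of the divisor of a
function `g ∈ 𝔪`, as in the proof of Lemma (14.1), p. 224), with the same proof: `h⁰ = Σ_w ℓ_T(Γ(U_w,𝒪)/(𝓘_η+I)(U_w))`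
(`H0ZeroDimensionalSubscheme`), `= Σ_w ord_{𝒪_{X,w}/𝔭_η}(t̄_D)·[κ(w):κ(𝔪)]` (`LocalColengthAtPoint`,
`ExceptionalCurveIntersectionH0` §1, §3), which is `(D·E)` term by term (Fulton, Thm. 2.4 Case 1, tree
`Motives.CartierDivisor.ordAt_pullbackAvoiding_ofPoint_eq_toNat_ord_quotient`).

* `finite_closure_inter_of_notMem` — `E_η ∩ Z` is a finite set of closed points for a closed `Z ∌ η`
  (`η` of height `1`);
* `ordAt_pullbackRep_ofIsEffectiveCartier_eq`, `…_eq_zero` — the local terms of `(D·E_η)` for `D = V(I)` avoiding `η`;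
* **`toNat_h0_sup_eq_excCurveDegree_of_notMem_support`** — `h0 π (𝓘_η ⊔ I)` is finite and equals
  `excCurveDegree π [V(I)] η`.

## References
* J. Lipman, Publ. Math. IHÉS 36 (1969), §12 Remark 2 c) (p. 221), §13 (p. 223), §14 proof of (14.1) (p. 224). [Lipman1969]
* W. Fulton, *Intersection Theory* (2nd ed. 1998), Thm. 2.4 (Case 1, p. 36), App. A.1. [Fulton1998]
* The Stacks Project, Tag 0BA8. [StacksProject]
-/

noncomputable section

open CategoryTheory AlgebraicGeometry TopologicalSpace IsLocalRing Order
open Literature.AlgebraicGeometry.Morphisms Literature.AlgebraicGeometry.Motives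
open Scheme.IdealSheafData

universe u

namespace Literature.AlgebraicGeometry.Resolution

/-! ## §1 `E ∩ Z` for a closed `Z` not containing `η` -/

section Finite

/-- In the specialisation order of a scheme, a proper specialisation is strictly smaller. [folklore] -/
private theorem lt_of_specializes_of_ne'' {X : Scheme.{u}} {x y : X} (h : y ⤳ x) (hne : x ≠ y) : x < y :=
  ⟨Scheme.le_iff_specializes.2 h, fun h' => hne ((Scheme.le_iff_specializes.1 h').antisymm h).eq⟩

/-- A strict specialisation of a point of height `≤ 1` is a closed point. [cite: StacksProject, Tag 0BA8] -/
theorem isClosed_singleton_of_specializes_of_ne {X : Scheme.{u}} {η w : X} (hη : Order.height η ≤ 1) (h : η ⤳ w)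
    (hwη : w ≠ η) : IsClosed ({w} : Set X) := by
  have hlt : w < η := lt_of_specializes_of_ne'' h hwη
  have h2 : Order.height w + 1 ≤ 1 := (Order.height_add_one_le hlt).trans hη
  have hw0 : Order.height w = 0 := by
    by_contra h0
    have h1 : (1 : ℕ∞) + 1 ≤ 1 := le_trans (by gcongr; exact Order.one_le_iff_ne_zero.mpr h0) h2
    exact absurd h1 (by decide)
  rw [← closure_eq_iff_isClosed]
  refine Set.Subset.antisymm (fun y hy => ?_) subset_closure
  have hwy : w ⤳ y := specializes_iff_mem_closure.2 hy
  by_contra hne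
  have hlt' : y < w := lt_of_specializes_of_ne'' hwy hne
  have h3 := Order.height_add_one_le hlt'
  rw [hw0] at h3
  exact absurd h3 (by simp)

/-- **`cl{η} ∩ Z` is finite for a closed set `Z` not containing the point `η` of height `≤ 1`** of a Noetherian
scheme: its points are closed points, hence maximal points of the closed set `cl{η} ∩ Z`, of which there are
finitely many. [cite: StacksProject, Tag 0BA8] -/
theorem finite_closure_inter_of_notMem {X : Scheme.{u}} [IsNoetherian X] {η : X} (hη : Order.height η ≤ 1)
    {Z : Set X} (hZ : IsClosed Z) (hηZ : η ∉ Z) : (closure ({η} : Set X) ∩ Z).Finite := by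
  have hc : IsClosed (closure ({η} : Set X) ∩ Z) := isClosed_closure.inter hZ
  refine (maxPoints_finite hc).subset fun z hz => ?_
  refine mem_maxPoints_iff.2 ⟨hz, fun w hw hwz => ?_⟩
  have hzη : z ≠ η := fun e => hηZ (e ▸ hz.2)
  have hzcl := isClosed_singleton_of_specializes_of_ne hη (specializes_iff_mem_closure.2 hz.1) hzη
  have : z ∈ closure ({w} : Set X) := specializes_iff_mem_closure.1 hwz
  have hwz' : w ⤳ z := hwz
  -- `z` closed: `w ⤳ z` with `w ∈ cl{η} ∩ Z`; and `z ⤳ w`? we need `w = z`: `z` is closed so `cl{z} = {z}`;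
  -- `w ⤳ z` means `z ∈ cl{w}`; conversely maximality asks `w = z` given `w ⤳ z`... use that `w` is also closed
  have hwη : w ≠ η := fun e => hηZ (e ▸ hw.2)
  have hwcl := isClosed_singleton_of_specializes_of_ne hη (specializes_iff_mem_closure.2 hw.1) hwη
  have : z ∈ ({w} : Set X) := by
    rw [← hwcl.closure_eq]
    exact specializes_iff_mem_closure.1 hwz'
  exact (Set.mem_singleton_iff.mp this).symm

end Finite

/-! ## §2 The local terms of `(D·E_η)` for `D = V(I)` avoiding `η` -/

section Terms

variable {T : Type u} [CommRing T] [IsLocalRing T] {X : Scheme.{u}} [IsIntegral X] [IsLocallyNoetherian X]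
  (π : X ⟶ Spec (.of T))

omit [IsLocalRing T] [IsLocallyNoetherian X] in
/-- `V(I)` avoids the generic point of `E_η` when `η ∉ V(I)`. [folklore] -/
private theorem avoids_ι_genericPoint_of_notMem {η : X} (I : X.IdealSheafData) (hI : IsEffectiveCartier I)
    (hηI : η ∉ I.support) :
    (CartierDivisor.ofIsEffectiveCartier I hI).Avoids
      ((ClosedSubvariety.ofPoint X η).ι (genericPoint (ClosedSubvariety.ofPoint X η).carrier)) := by
  have hgen := ClosedSubvariety.genericPoint_ofPoint (X := X) η
  unfold ClosedSubvariety.genericPoint at hgen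
  rw [hgen]
  exact (CartierDivisor.avoids_ofIsEffectiveCartier_iff _ hI η).mpr hηI

omit [IsIntegral X] [IsLocallyNoetherian X] in
/-- A point of `E_η` over a strict specialisation `x ≠ η` has height `0` in `E_η`. [cite: Lipman1969, Section 10 (p. 212)] -/
private theorem height_ofPointPt_eq_zero' {η x : X} (hη : η ∈ excCurvePoints π) (hx : η ⤳ x) (hxη : x ≠ η) :
    Order.height (ClosedSubvariety.ofPointPt η hx) = 0 := by
  have hE1 := height_top_ofPoint_eq_one π hη
  have hne : ClosedSubvariety.ofPointPt η hx ≠ (⊤ : ↥(ClosedSubvariety.ofPoint X η).carrier) := by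
    intro h
    apply hxη
    have hgen := ClosedSubvariety.genericPoint_ofPoint (X := X) η
    unfold ClosedSubvariety.genericPoint at hgen
    calc x = (ClosedSubvariety.ofPoint X η).ι (ClosedSubvariety.ofPointPt η hx) := rfl
      _ = (ClosedSubvariety.ofPoint X η).ι (⊤ : ↥(ClosedSubvariety.ofPoint X η).carrier) := by rw [h]
      _ = η := hgen
  have hlt : ClosedSubvariety.ofPointPt η hx < (⊤ : ↥(ClosedSubvariety.ofPoint X η).carrier) := by
    refine lt_iff_le_not_ge.mpr ⟨le_top, fun h => hne ?_⟩
    exact ((Scheme.le_iff_specializes.mp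
      (le_top : ClosedSubvariety.ofPointPt η hx ≤ (⊤ : ↥(ClosedSubvariety.ofPoint X η).carrier))).antisymm
      (Scheme.le_iff_specializes.mp h)).eq.symm
  have hfin : Order.height (ClosedSubvariety.ofPointPt η hx) < ⊤ :=
    lt_of_le_of_lt ((Order.height_mono hlt.le).trans_eq hE1) (ENat.coe_lt_top 1)
  have h := Order.height_strictMono hlt hfin
  rw [hE1] at h
  exact Order.lt_one_iff.mp h

/-- **The local term of `(D·E_η)` at a point `w ≠ η` of `E_η` is `ord_{𝒪_{X,w}/𝔭_η}(t̄_w)`**, `t_w` the local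
equation of the effective Cartier divisor `D = V(I)` (`η ∉ V(I)`) at `w` (Fulton, Thm. 2.4, Case 1).
[cite: Fulton1998, Theorem 2.4 (Case 1 of the proof, p. 36)] -/
theorem ordAt_pullbackRep_ofIsEffectiveCartier_eq [IsProper π] {η w : X} (hη : η ∈ excCurvePoints π)
    (I : X.IdealSheafData) (hI : IsEffectiveCartier I) (hηI : η ∉ I.support) (h : η ⤳ w) (hwη : w ≠ η) :
    ((CartierDivisor.ofIsEffectiveCartier I hI).pullbackRep (ClosedSubvariety.ofPoint X η).ι).ordAt
        (ClosedSubvariety.ofPointPt η h) =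
      ((Ring.ord (X.presheaf.stalk w ⧸ primeOfSpecializes h)
        (Ideal.Quotient.mk _ (X.presheaf.germ (CartierDivisor.cartierChart _ hI w : X.Opens) w
          (CartierDivisor.mem_cartierChart _ hI w) (CartierDivisor.cartierGen _ hI w)))).toNat : ℤ) := by
  have hav := avoids_ι_genericPoint_of_notMem (X := X) (η := η) I hI hηI
  rw [CartierDivisor.pullbackRep_of_avoids _ _ hav]
  obtain ⟨q, hq⟩ := exists_fac_specResidueField π hη.1
  haveI : IsIntegral (Over.mk q : SchemeOver (ResidueField T)).left :=
    inferInstanceAs (IsIntegral (ClosedSubvariety.ofPoint X η).carrier)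
  haveI : IsProper (Over.mk q : SchemeOver (ResidueField T)).hom := isProper_of_fac_specResidueField π hq
  have hcoh : coheight (ClosedSubvariety.ofPointPt η h) = 1 :=
    CartierDivisor.coheight_eq_one_of_height_eq_zero (C := (Over.mk q : SchemeOver (ResidueField T)))
      (height_top_ofPoint_eq_one π hη) (height_ofPointPt_eq_zero' π hη h hwη)
  have hD : (CartierDivisor.ofIsEffectiveCartier I hI).Avoids η :=
    (CartierDivisor.avoids_ofIsEffectiveCartier_iff _ hI η).2 hηI
  have htz := (CartierDivisor.avoids_iff_notMem_of_eq (i := w) h (CartierDivisor.mem_cartierChart _ hI w)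
    (toFunctionField_germ_cartierGen _ hI w)).1 hD
  exact CartierDivisor.ordAt_pullbackAvoiding_ofPoint_eq_toNat_ord_quotient (i := w) h
    (CartierDivisor.mem_cartierChart _ hI w) (toFunctionField_germ_cartierGen _ hI w) hav hcoh htz

omit [IsLocalRing T] in
/-- Off `V(I)` the local term of `(D·E_η)` vanishes. [cite: Fulton1998, Definition 1.4] -/
theorem ordAt_pullbackRep_ofIsEffectiveCartier_eq_zero {η w : X} (I : X.IdealSheafData) (hI : IsEffectiveCartier I)
    (hηI : η ∉ I.support) (h : η ⤳ w) (hw : w ∉ I.support) :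
    ((CartierDivisor.ofIsEffectiveCartier I hI).pullbackRep (ClosedSubvariety.ofPoint X η).ι).ordAt
        (ClosedSubvariety.ofPointPt η h) = 0 := by
  have hav := avoids_ι_genericPoint_of_notMem (X := X) (η := η) I hI hηI
  rw [CartierDivisor.pullbackRep_of_avoids _ _ hav]
  have hDw : (CartierDivisor.ofIsEffectiveCartier I hI).Avoids w :=
    (CartierDivisor.avoids_ofIsEffectiveCartier_iff _ hI w).2 hw
  have hav' : ((CartierDivisor.ofIsEffectiveCartier I hI).pullbackAvoiding
      (ClosedSubvariety.ofPoint X η).ι hav).Avoids (ClosedSubvariety.ofPointPt η h) :=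
    fun i hi => (hDw i.1 hi).pullbackFn
  exact hav'.ordAt_eq_zero

end Terms

/-! ## §3 `(D·E_η) = h⁰(𝒪_{E_η ∩ D})` -/

section Main

variable {T : Type u} [CommRing T] [IsNoetherianRing T] [IsLocalRing T]
  {X : Scheme.{u}} [IsIntegral X] [IsLocallyNoetherian X] {π : X ⟶ Spec (.of T)}

omit [IsNoetherianRing T] [IsLocalRing T] [IsIntegral X] [IsLocallyNoetherian X] in
/-- `x ∈ supp(I ⊔ J) ↔ x ∈ supp I ∧ x ∈ supp J`. [folklore] -/
private theorem mem_support_sup_iff' (I J : X.IdealSheafData) (x : X) :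
    x ∈ (I ⊔ J).support ↔ x ∈ I.support ∧ x ∈ J.support := by
  rw [mem_support_iff_stalkIdeal_le, mem_support_iff_stalkIdeal_le, mem_support_iff_stalkIdeal_le, stalkIdeal_sup,
    sup_le_iff]

/-- **`(D·E_η) = h⁰(𝒪_{E_η ∩ D})` for an effective Cartier divisor `D = V(I)` with `η ∉ V(I)`** (Lipman §12 Remark 2 c):
"`(𝒪_X(𝒟)·C) = h⁰((i^*𝒟))`" for the integral curve `C = E_η`), on a proper `π : X → Spec T` (`T` Noetherian local,
`X` integral): `h0 π (𝓘_η ⊔ I)` is finite and `(h0 π (𝓘_η ⊔ I)).toNat = excCurveDegree π [V(I)] η`.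
[cite: Lipman1969, Section 12, Remark 2 c) (p. 221)] [cite: Fulton1998, Theorem 2.4 (Case 1 of the proof, p. 36)] -/
theorem toNat_h0_sup_eq_excCurveDegree_of_notMem_support [IsProper π] {η : X} (hη : η ∈ excCurvePoints π)
    (I : X.IdealSheafData) (hI : IsEffectiveCartier I) (hηI : η ∉ I.support) :
    h0 π (primeDivisorIdeal η ⊔ I) ≠ ⊤ ∧
      ((h0 π (primeDivisorIdeal η ⊔ I)).toNat : ℤ) =
        excCurveDegree π (CartierDivisor.ofIsEffectiveCartier I hI) η := by
  classical
  haveI : IsNoetherian X := by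
    haveI : CompactSpace X := QuasiCompact.compactSpace_of_compactSpace π
    exact {}
  set 𝓙 : X.IdealSheafData := primeDivisorIdeal η ⊔ I with h𝓙
  set Zs : Set X := closure ({η} : Set X) ∩ (I.support : Set X) with hZs
  have hZ : Zs.Finite := finite_closure_inter_of_notMem hη.2.le I.support.isClosed hηI
  have hZcl : ∀ p ∈ Zs, IsClosed ({p} : Set X) := fun p hp =>
    isClosed_singleton_of_specializes_of_ne hη.2.le (specializes_iff_mem_closure.2 hp.1) (fun e => hηI (e ▸ hp.2))
  have hsupp : (𝓙.support : Set X) ⊆ Zs := by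
    intro x hx
    have hx' := (mem_support_sup_iff' (primeDivisorIdeal η) I x).mp hx
    refine ⟨?_, hx'.2⟩
    have h1 := hx'.1
    rw [← SetLike.mem_coe, coe_support_primeDivisorIdeal] at h1
    exact h1
  -- the points of `E ∩ D`
  have hsp : ∀ p : Zs, η ⤳ p.1 := fun p => specializes_iff_mem_closure.2 p.2.1
  have hpη : ∀ p : Zs, p.1 ≠ η := fun p e => hηI (e ▸ p.2.2)
  have hcl : ∀ p : Zs, π.base p.1 = closedPoint T := fun p => base_eq_closedPoint_of_specializes π hη.1 (hsp p)
  -- `h⁰` as a sum of local colengths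
  obtain ⟨U, hUaff, hU, hU', hsum⟩ := exists_h0_eq_sum_length_quotient π 𝓙 hZ hZcl hsupp
  letI := hZ.fintype
  have honly : ∀ p : Zs, ∀ q ∈ U p.1, q ∈ 𝓙.support → q = p.1 := fun p q hq hqs => hU' p.1 p.2 q (hsupp hqs) hq
  let tD : ∀ w : X, X.presheaf.stalk w := fun w => X.presheaf.germ
    (CartierDivisor.cartierChart _ hI w : X.Opens) w (CartierDivisor.mem_cartierChart _ hI w) (CartierDivisor.cartierGen _ hI w)
  let ordT : Zs → ℕ∞ := fun p =>
    Ring.ord (X.presheaf.stalk p.1 ⧸ primeOfSpecializes (hsp p)) (Ideal.Quotient.mk _ (tD p.1))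
  let κℓ : Zs → ℕ∞ := fun p =>
    letI : Algebra T (X.presheaf.stalk p.1) :=
      ((X.presheaf.germ ⊤ p.1 trivial).hom.comp (Morphisms.algebraMapΓ π)).toAlgebra
    haveI : IsLocalHom (algebraMap T (X.presheaf.stalk p.1)) := isLocalHom_germ_algebraMapΓ π (hcl p)
    Module.length (ResidueField T) (ResidueField (X.presheaf.stalk p.1))
  have hA : ∀ p : Zs, Module.length T (Sections π (U p.1) ⧸
      (𝓙.ideal ⟨U p.1, hUaff p.1 p.2⟩).comap (Sections.equiv π (U p.1)).toRingHom) = ordT p * κℓ p := by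
    intro p
    rw [length_quotient_sections_eq_mul π 𝓙 (hUaff p.1 p.2) (hU p.1 p.2) (hcl p) (honly p),
      h𝓙, length_quotient_stalkIdeal_sup_eq_ord (hsp p) I hI]
  have hsumA : h0 π 𝓙 = ∑ p : Zs, ordT p * κℓ p := by
    rw [hsum]
    exact Fintype.sum_congr _ _ fun p => hA p
  have hfin : h0 π 𝓙 ≠ ⊤ := by
    refine h0_ne_top_of_base_eq_closedPoint π 𝓙 fun x => ?_
    have hx : 𝓙.subschemeι.base x ∈ (𝓙.support : Set X) :=
      (Set.ext_iff.mp (Scheme.IdealSheafData.range_subschemeι (I := 𝓙)) _).mp (Set.mem_range_self x)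
    exact base_eq_closedPoint_of_specializes π hη.1 (specializes_iff_mem_closure.2 (hsupp hx).1)
  let n : Zs → ℕ := fun p => (ordT p).toNat * π.residueDegree p.1
  have hterm : ∀ p : Zs, ordT p * κℓ p = (n p : ℕ∞) := by
    intro p
    have hle : ordT p * κℓ p ≤ h0 π 𝓙 := by
      rw [hsumA]
      exact Finset.single_le_sum (f := fun p => ordT p * κℓ p) (fun i _ => bot_le) (Finset.mem_univ p)
    have hne_top : ordT p * κℓ p ≠ ⊤ := ne_top_of_le_ne_top hfin hle
    by_cases h0p : ordT p = 0
    · simp only [n, h0p, zero_mul, ENat.toNat_zero, Nat.cast_zero]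
    · have hκ : κℓ p ≠ ⊤ := fun h => hne_top (WithTop.mul_eq_top_iff.mpr (Or.inl ⟨h0p, h⟩))
      have hκpos : κℓ p ≠ 0 := by
        letI : Algebra T (X.presheaf.stalk p.1) :=
          ((X.presheaf.germ ⊤ p.1 trivial).hom.comp (Morphisms.algebraMapΓ π)).toAlgebra
        haveI : IsLocalHom (algebraMap T (X.presheaf.stalk p.1)) := isLocalHom_germ_algebraMapΓ π (hcl p)
        change Module.length (ResidueField T) (ResidueField (X.presheaf.stalk p.1)) ≠ 0
        exact Module.length_pos.ne'
      have hord : ordT p ≠ ⊤ := fun h => hne_top (WithTop.mul_eq_top_iff.mpr (Or.inr ⟨h, hκpos⟩))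
      have hκeq : κℓ p = π.residueDegree p.1 := length_residueField_eq_residueDegree π (hcl p) hκ
      simp only [n]
      rw [hκeq, Nat.cast_mul, ENat.coe_toNat hord]
  have hsumN : h0 π 𝓙 = ((∑ p : Zs, n p : ℕ) : ℕ∞) := by
    rw [hsumA, Nat.cast_sum]
    exact Fintype.sum_congr _ _ fun p => hterm p
  refine ⟨hfin, ?_⟩
  rw [hsumN, ENat.toNat_coe, Nat.cast_sum]
  rw [excCurveDegree_eq_finsum_dite π _ η]
  set G : X → ℤ := fun w => if h : η ⤳ w then
      ((CartierDivisor.ofIsEffectiveCartier I hI).pullbackRep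
        (ClosedSubvariety.ofPoint X η).ι).ordAt (ClosedSubvariety.ofPointPt η h) * ((π.residueDegree w : ℕ) : ℤ)
    else 0 with hG
  have hGsupp : Function.support G ⊆ Zs := by
    intro w hw
    rw [Function.mem_support] at hw
    by_cases h : η ⤳ w
    · by_cases h' : w ∈ I.support
      · exact ⟨specializes_iff_mem_closure.1 h, h'⟩
      · exfalso
        apply hw
        rw [hG]
        simp only [dif_pos h, ordAt_pullbackRep_ofIsEffectiveCartier_eq_zero I hI hηI h h', zero_mul]
    · exfalso
      apply hw
      rw [hG]
      simp only [dif_neg h]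
  rw [finsum_eq_sum_of_support_subset_of_finite G hGsupp hZ, Set.Finite.toFinset_eq_toFinset,
    ← Finset.sum_set_coe]
  refine (Fintype.sum_congr _ _ fun p => ?_).symm
  rw [hG]
  simp only [dif_pos (hsp p), n]
  rw [ordAt_pullbackRep_ofIsEffectiveCartier_eq π hη I hI hηI (hsp p) (hpη p), Nat.cast_mul]

end Main

end Literature.AlgebraicGeometry.Resolution

end
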